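import Summits.QuantumFields.YangMills.Theorems.BalabanUVNodesPortS1ClassTwins
import Summits.QuantumFields.YangMills.Theorems.BalabanUVNodesPortS1FECutsInUcNear

/-!
# NODE O port PT-A — THE NESTING `InRegClass → CutsInUc` REDUCED TO ITS TWO GENUINE INPUTS (g11; sharpening of the third conjunct of ✓`ClassP5NestReg` ∕ ✓`ClassNestsUc` for the supplier):
# at a class point, every cut pair of `U_{k+1}(W_B)` lies in `U^c_{k+1}(X, α₀, α₁)` AS SOON AS (1.12)'s LOCAL GAUGES with `|A|, |∇^ξ A| < c_B α₀` exist on the record's cubes AND (1.14)'s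
# CURRENT BOUND `|J(U_{k+1}(W_B))| < α₀` holds on the bonds of `X` — everything else ((1.11) plaquettes from the class, (1.13) with `A′ := 0`, (iv) vacuous at the record, `Gᶜ`∕`𝔤ᶜ`-valuedness,
# the cut packaging) is bookkeeping, done here

Cell `ym-nodeO-ideate`, porter seat PT-A-1 (gen 11); `--kind proof --supports stmt-QuantumFields-27930 --as helper`; count-neutral.  [I] = [Balaban1987RG1]; [15] = [Balaban1985Variational].

WHY.  ✓`ClassP5NestReg`'s last conjunct (= ✓`ClassNestsUc`'s body) asks `InRegClass … ε₀ … B → CutsInUc … α₀ α₁ … B` — print's «U_k(ε₀) ⊂ U^c_j(X, α₀, α₁)» (p.263 L5–13).  The germ edition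
(✓`…FECutsInUcNear.eventually_cutsInUc`, hand-FE-1) runs through ✓`satisfies_recordPair`, which takes the factorisation `U := 1`, `A′ := (iξ)⁻¹ log 𝐔` and needs `|𝐔(b) − 1| < α₁ξ²∕8` bondwise —
available near `B = 0` by continuity, NOT on the class (in the rooted gauge a class minimiser has `|U(b) − 1| = O(ε₀ξ)` at best).  On the class the right factorisation is `U := 𝐔` (the rooted
minimiser itself, `G`-valued), `A′ := 0`: then (1.11) is the class's own plaquette bound (`ε₀ ≤ α₀`), (1.13) is trivial, (iv) is vacuous at the record (✓`condIV_record`), and EXACTLY TWO clauses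
remain, both [15] Thm 1's regularity of the minimiser (the discrete Yang–Mills equation), neither implied by small plaquettes: (1.12) local gauges on the record's `M`-cubes with `|A| < c_Bα₀`
(axial gauge ✓`exists_isGaugeOn_expMul_of_plaqSmallOn` would give it) AND `|∇^ξ A| < c_Bα₀` (a sum of up to `Mξ⁻¹` plaquette DIFFERENCES — second order), and (1.14) `|J(𝐔)| < α₀`, where
`J = ξ⁻¹ D*(ξ⁻² π Im ∂𝐔)` is ξ⁻³ × DIFFERENCES of adjacent plaquette variables (the tree's `bgReg` omits print's current clause of (1.2) — divergence D-defB-1 — so the class does not carry it).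
This file proves the reduction, so the supplier's deliverable for the nesting is precisely {(1.12) with gradients, (1.14)} at class points.
* §1 ★ `satisfies_of_localGauges` — an `SU(2)`-valued `𝐔` with plaquettes `< α₀ξ²` inside `X`, (1.12) local gauges on the cubes of record, and a traceless `𝐉` with `|𝐉| < α₀` on the bonds of `X`
  satisfies (i)–(iv) of record with `U := 𝐔`, `A′ := 0` (any `α₁ > 0`).
* §2 ★★ `cutsInUc_of_inRegClass_of_localGauges` — at a class point `B` (`ε₀ ≤ α₀`): local gauges for `U_{k+1}(W_B)` on the cubes of every `X` + the current bound on the bonds of every `X`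
  ⟹ `CutsInUc … α₀ α₁ … B`.

HONEST FRAMING.  Bookkeeping over ✓`B12RegularSpaces111.Satisfies`; the two displayed inputs are [15] Thm 1 content, NOT proved here; no new letter (`def`) is introduced (★★★ №633 (d)); nothing of
Bałaban's RG estimates asserted, ported or discharged; `ClassP5NestReg` ∕ `ClassNestsUc` ∕ `P0HolExtAtRecordGL` ∕ `FEStepReg` inhabited NOWHERE; ⟨27930⟩ OPEN 1∕4 · no claim; NODE O 0∕1; COUNT
8∕28 · K 1∕4 UNMOVED; finite `𝕋⁴_{L^K}` at fixed ε — NOT continuum ∕ OS; **the Yang–Mills mass gap (Clay) is NOT proved by any of this.**  No `sorry`, no `def`, no `instance`; standard axioms.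
-/

noncomputable section

open scoped BigOperators Matrix.Norms.L2Operator Topology
open Filter

namespace Summit.QuantumFields.YangMills.Theorems.BalabanUVNodesPortS1

open Summit.QuantumFields.YangMills.Theorems.K0RecordFormatNames
open Literature.MathematicalPhysics.QuantumFieldTheory.Balaban1983to89
open Literature.MathematicalPhysics.QuantumFieldTheory.Balaban1983to89.Node00
open Literature.MathematicalPhysics.QuantumFieldTheory.Balaban1983to89.T4Continuum (T4Family)

variable (F : T4Family)

/-! ## §1  (i)–(iv) of record from local gauges and the current bound, factorisation `U := 𝐔`, `A′ := 0` -/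

/-- ★ **AN `SU(2)`-VALUED `𝐔` WITH SMALL PLAQUETTES INSIDE `X`, (1.12) LOCAL GAUGES ON THE CUBES OF RECORD, AND A SMALL TRACELESS `𝐉` ON THE BONDS OF `X` SATISFIES (i)–(iv) OF RECORD** with
radii `(α₀, α₁, γ₀ := α₀)`, through the factorisation `𝐔 = exp(iξ·0)·𝐔` ((i) for `U := 𝐔`: `G`-valued, (1.11) = the plaquette hypothesis, (1.12) = the local-gauge hypothesis; (ii) for
`A′ := 0`: trivial; (iii) = plaquettes + the current hypothesis; (iv) vacuous at the record's unit recipe, ✓`condIV_record`).  NO bondwise nearness of `𝐔` to `1` is asked (contrast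
✓`satisfies_recordPair`). [cite: Balaban1987RG1, (1.11)–(1.16) p.262, p.263 L5–13; Balaban1985Variational, Thm 1 p.279 («the conditions are satisfied by the minimal configurations»)] -/
theorem satisfies_of_localGauges (Mc k K : ℕ) (X : (recordDomSys F Mc k K).Dom) {α₀ α₁ : ℝ} (hα₀ : 0 < α₀) (hα₁ : 0 < α₁)
    (U : GaugeField (F.P K) 0 (SU 2)) (J : PBond (F.P K) 0 → MatA 2)
    (hplaq : ∀ p ∈ (Sect2.regionOfSet (F.P K) (Sect2.domSites (F.P K) Mc (k + 1) X)).plaqs,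
      ‖((B12RegularSpaces111.plaq (fun b => ιSU 2 (U b)) p : (MatA 2)ˣ) : MatA 2) - 1‖ < α₀ * (F.P K).eta (k + 1) ^ 2)
    (hloc : ∀ C ∈ (Sect2.frameI (RzOfRecord F 2 K) Mc (k + 1) (Sect2.domSites (F.P K) Mc (k + 1) X)).cubes,
      ∃ u : Site (F.P K) 0 → (MatA 2)ˣ, (∀ x, u x ∈ (B12RegularSpaces111SpecialUnitary.suModel 2).G) ∧ ∃ A : PBond (F.P K) 0 → MatA 2,
        (∀ b ∈ C.bonds, B12RegularSpaces111.gaugeU u (fun b => ιSU 2 (U b)) b =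
          B12RegularSpaces111.expI (B12RegularSpaces111.StepConsts.ofParams (F.P K) (recordCB F) (k + 1)).ξ (A b)) ∧
        (∀ b ∈ C.bonds, ‖A b‖ < (B12RegularSpaces111.StepConsts.ofParams (F.P K) (recordCB F) (k + 1)).cB * α₀) ∧
        ∀ q ∈ C.dpairs, ‖B12RegularSpaces111.grad (B12RegularSpaces111.StepConsts.ofParams (F.P K) (recordCB F) (k + 1)).ξ q.2.1 (fun y => A ⟨y, q.2.2⟩) q.1‖ <
          (B12RegularSpaces111.StepConsts.ofParams (F.P K) (recordCB F) (k + 1)).cB * α₀)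
    (hJtr : ∀ b, (J b).trace = 0)
    (hJlt : ∀ b ∈ (Sect2.regionOfSet (F.P K) (Sect2.domSites (F.P K) Mc (k + 1) X)).bonds, ‖J b‖ < α₀) :
    B12RegularSpaces111.Satisfies (B12RegularSpaces111SpecialUnitary.suModel 2)
      (Sect2.frameI (RzOfRecord F 2 K) Mc (k + 1) (Sect2.domSites (F.P K) Mc (k + 1) X))
      (B12RegularSpaces111.StepConsts.ofParams (F.P K) (recordCB F) (k + 1)) α₀ α₁ α₀ ⟨fun b => ιSU 2 (U b), J⟩ := by
  set ξ : ℝ := (F.P K).eta (k + 1) with hξdef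
  have hξ : 0 < ξ := pow_pos (inv_pos.mpr (Nat.cast_pos.mpr (F.P K).L_pos)) _
  refine ⟨fun b _ => B12RegularSpaces111SpecialUnitary.suModel_G_le_Gc (ιSU_mem_G 2 (U b)),
    fun b _ => B12RegularSpaces111SpecialUnitary.mem_suModel_gc.2 (hJtr b), (fun b => ιSU 2 (U b)), 0, fun b => ?_, ?_, ?_, ?_,
    K0PortChart44DMapsTo.condIV_record F Mc k K X hα₀ _, K0PortChart44DMapsTo.condIV_record F Mc k K X hα₀ _⟩
  · -- the factorisation `𝐔 = exp(iξ·0) · 𝐔`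
    have h1 : B12RegularSpaces111.expI (B12RegularSpaces111.StepConsts.ofParams (F.P K) (recordCB F) (k + 1)).ξ ((0 : PBond (F.P K) 0 → MatA 2) b) = 1 :=
      Units.ext (by simp [B12RegularSpaces111.expI, Beta.BackgroundVertices.val_expUnit])
    rw [h1, one_mul]
  · -- (i) for `U := 𝐔`
    exact ⟨fun b _ => ιSU_mem_G 2 (U b), fun p hp => by simpa only [B12RegularSpaces111.StepConsts.ofParams] using hplaq p hp, hloc⟩
  · -- (ii) for `A′ := 0`
    refine ⟨fun b _ => Submodule.zero_mem _, fun b _ => by simpa using hα₁, fun q _ => ?_⟩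
    simp only [B12RegularSpaces111.nabla, Pi.zero_apply, mul_zero, zero_mul, sub_self, smul_zero, norm_zero]
    exact hα₁
  · -- (iii)
    exact ⟨fun p hp => by simpa only [B12RegularSpaces111.StepConsts.ofParams] using hplaq p hp, hJlt⟩

/-! ## §2  ★★ At a class point: local gauges + the current bound ⟹ `CutsInUc` -/

open scoped Classical in
/-- ★★ **THE NESTING AT A CLASS POINT, REDUCED TO (1.12) AND (1.14)**: at `B` with `InRegClass … ε₀ … B`, `0 < ε₀ ≤ α₀`, `0 < α₁`, IF on every cube of record of every domain `X` the rooted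
background `U_{k+1}(W_B)` has a (1.12) local gauge (`G`-valued `u`, `U^u = exp iξA` on the cube's bonds, `|A|, |∇^ξ A| < c_B α₀`) AND its (1.8) current obeys `|J(U_{k+1}(W_B))(b)| < α₀` on the
bonds of every `X`, THEN `CutsInUc … α₀ α₁ … B` (every cut pair in its record space) — §1 applied to the cut pair (cut field = field on the bonds of `X` ⊇ the cubes' bonds, cut plaquettes inside `X`
= plaquettes (✓`plaq_cut_eq_of_mem_plaqInside`), whose deviation `< ε₀ξ² ≤ α₀ξ²` is the class's own bound (✓`dist1_plaqHol_recordBgField_eq`)).  The two displayed inputs are [15] Thm 1's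
regularity; nothing else of the nesting is genuine. [cite: Balaban1987RG1, p.263 L5–13, (1.11)–(1.16) p.262, (1.1)–(1.2) p.260, (1.8) p.261; Balaban1985Variational, Thm 1 p.279, (19)–(20) p.281] -/
theorem cutsInUc_of_inRegClass_of_localGauges (a₀ ε₂₉ : ℝ) (Mc k n : ℕ) {ε₀ α₀ α₁ : ℝ} (hε₀α : ε₀ ≤ α₀) (hα₀ : 0 < α₀) (hα₁ : 0 < α₁)
    {B : recordW F a₀ ε₂₉ k (recordK₀ F Mc k + n)} (hB : InRegClass F Mc k ε₀ a₀ ε₂₉ n B)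
    (hloc : letI θ := thetaFill F a₀ ε₂₉
      ∀ (X : (recordDomSys F Mc k (recordK₀ F Mc k + n)).Dom),
      ∀ C ∈ (Sect2.frameI (RzOfRecord F 2 (recordK₀ F Mc k + n)) Mc (k + 1) (Sect2.domSites (F.P (recordK₀ F Mc k + n)) Mc (k + 1) X)).cubes,
        ∃ u : Site (F.P (recordK₀ F Mc k + n)) 0 → (MatA 2)ˣ, (∀ x, u x ∈ (B12RegularSpaces111SpecialUnitary.suModel 2).G) ∧ ∃ A : PBond (F.P (recordK₀ F Mc k + n)) 0 → MatA 2,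
          (∀ b ∈ C.bonds, B12RegularSpaces111.gaugeU u (recordBgUnits F θ k (recordK₀ F Mc k + n) B) b =
            B12RegularSpaces111.expI (B12RegularSpaces111.StepConsts.ofParams (F.P (recordK₀ F Mc k + n)) (recordCB F) (k + 1)).ξ (A b)) ∧
          (∀ b ∈ C.bonds, ‖A b‖ < (B12RegularSpaces111.StepConsts.ofParams (F.P (recordK₀ F Mc k + n)) (recordCB F) (k + 1)).cB * α₀) ∧
          ∀ q ∈ C.dpairs, ‖B12RegularSpaces111.grad (B12RegularSpaces111.StepConsts.ofParams (F.P (recordK₀ F Mc k + n)) (recordCB F) (k + 1)).ξ q.2.1 (fun y => A ⟨y, q.2.2⟩) q.1‖ <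
            (B12RegularSpaces111.StepConsts.ofParams (F.P (recordK₀ F Mc k + n)) (recordCB F) (k + 1)).cB * α₀)
    (hcur : letI θ := thetaFill F a₀ ε₂₉
      ∀ (X : (recordDomSys F Mc k (recordK₀ F Mc k + n)).Dom), ∀ b ∈ domBonds F Mc k (recordK₀ F Mc k + n) X,
        ‖recordCurrent F θ k (recordK₀ F Mc k + n) B b‖ < α₀) :
    CutsInUc F Mc k α₀ α₁ a₀ ε₂₉ n B := by
  letI θ := thetaFill F a₀ ε₂₉; letI := θ.instVβ₁; letI := θ.instVβ₂; letI := θ.instιβ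
  -- the class's plaquette bound
  have hplaqB : PlaqSmall (ε₀ * (F.P (recordK₀ F Mc k + n)).eta (k + 1) ^ 2) (recordBgField F θ k (recordK₀ F Mc k + n) B) :=
    (mem_bgReg_iff F 2 (recordK₀ F Mc k + n) (k + 1) ε₀ _).1 hB.2
  intro X
  -- the cut pair as an `SU(2)`-valued field and a current
  set Uc : GaugeField (F.P (recordK₀ F Mc k + n)) 0 (SU 2) := fun b => if b ∈ domBonds F Mc k (recordK₀ F Mc k + n) X then recordBgField F θ k (recordK₀ F Mc k + n) B b else 1 with hUc
  set Jc : PBond (F.P (recordK₀ F Mc k + n)) 0 → MatA 2 := fun b => if b ∈ domBonds F Mc k (recordK₀ F Mc k + n) X then recordCurrent F θ k (recordK₀ F Mc k + n) B b else 0 with hJc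
  have hcutU : (fun b => ιSU 2 (Uc b)) = fun b => if b ∈ domBonds F Mc k (recordK₀ F Mc k + n) X then recordBgUnits F θ k (recordK₀ F Mc k + n) B b else 1 := by
    funext b
    by_cases hb : b ∈ domBonds F Mc k (recordK₀ F Mc k + n) X
    · simp only [hUc, if_pos hb]; rfl
    · simp only [hUc, if_neg hb, map_one]
  -- (1.11) inside `X`: the class's own plaquette bound
  have hplaq : ∀ p ∈ (Sect2.regionOfSet (F.P (recordK₀ F Mc k + n)) (Sect2.domSites (F.P (recordK₀ F Mc k + n)) Mc (k + 1) X)).plaqs,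
      ‖((B12RegularSpaces111.plaq (fun b => ιSU 2 (Uc b)) p : (MatA 2)ˣ) : MatA 2) - 1‖ < α₀ * (F.P (recordK₀ F Mc k + n)).eta (k + 1) ^ 2 := by
    intro p hpX
    rw [hcutU, plaq_cut_eq_of_mem_plaqInside F Mc k (recordK₀ F Mc k + n) X (recordBgUnits F θ k (recordK₀ F Mc k + n) B) hpX, ← dist1_plaqHol_recordBgField_eq]
    have h1 : dist1 (GaugeField.plaqHol (recordBgField F θ k (recordK₀ F Mc k + n) B) p) < ε₀ * (F.P (recordK₀ F Mc k + n)).eta (k + 1) ^ 2 := hplaqB p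
    have h2 : ε₀ * (F.P (recordK₀ F Mc k + n)).eta (k + 1) ^ 2 ≤ α₀ * (F.P (recordK₀ F Mc k + n)).eta (k + 1) ^ 2 := mul_le_mul_of_nonneg_right hε₀α (sq_nonneg _)
    exact lt_of_lt_of_le h1 h2
  -- (1.12): the cubes' bonds are bonds of `X`, where the cut field IS the field
  have hloc' : ∀ C ∈ (Sect2.frameI (RzOfRecord F 2 (recordK₀ F Mc k + n)) Mc (k + 1) (Sect2.domSites (F.P (recordK₀ F Mc k + n)) Mc (k + 1) X)).cubes,
      ∃ u : Site (F.P (recordK₀ F Mc k + n)) 0 → (MatA 2)ˣ, (∀ x, u x ∈ (B12RegularSpaces111SpecialUnitary.suModel 2).G) ∧ ∃ A : PBond (F.P (recordK₀ F Mc k + n)) 0 → MatA 2,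
        (∀ b ∈ C.bonds, B12RegularSpaces111.gaugeU u (fun b => ιSU 2 (Uc b)) b =
          B12RegularSpaces111.expI (B12RegularSpaces111.StepConsts.ofParams (F.P (recordK₀ F Mc k + n)) (recordCB F) (k + 1)).ξ (A b)) ∧
        (∀ b ∈ C.bonds, ‖A b‖ < (B12RegularSpaces111.StepConsts.ofParams (F.P (recordK₀ F Mc k + n)) (recordCB F) (k + 1)).cB * α₀) ∧
        ∀ q ∈ C.dpairs, ‖B12RegularSpaces111.grad (B12RegularSpaces111.StepConsts.ofParams (F.P (recordK₀ F Mc k + n)) (recordCB F) (k + 1)).ξ q.2.1 (fun y => A ⟨y, q.2.2⟩) q.1‖ <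
          (B12RegularSpaces111.StepConsts.ofParams (F.P (recordK₀ F Mc k + n)) (recordCB F) (k + 1)).cB * α₀ := by
    intro C hC
    obtain ⟨u, hu, A, hA, hAn, hAg⟩ := hloc X C hC
    refine ⟨u, hu, A, fun b hb => ?_, hAn, hAg⟩
    obtain ⟨a, -, -, hCeq⟩ := hC
    have hbX : b ∈ domBonds F Mc k (recordK₀ F Mc k + n) X := by
      have hb' := hb
      rw [hCeq] at hb'
      exact ⟨hb'.1.2, hb'.2.2⟩
    rw [← hA b hb]
    have hcb : ιSU 2 (Uc b) = recordBgUnits F θ k (recordK₀ F Mc k + n) B b := by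
      have := congrFun hcutU b
      simp only [if_pos hbX] at this
      exact this
    show B12RegularSpaces111.gaugeU u (fun b => ιSU 2 (Uc b)) b = B12RegularSpaces111.gaugeU u (recordBgUnits F θ k (recordK₀ F Mc k + n) B) b
    simp only [B12RegularSpaces111.gaugeU, hcb]
  -- (1.14) on the bonds of `X`
  have hJtr : ∀ b, (Jc b).trace = 0 := by
    intro b
    by_cases hb : b ∈ domBonds F Mc k (recordK₀ F Mc k + n) X
    · simp only [hJc, if_pos hb]; exact trace_recordCurrent F θ k (recordK₀ F Mc k + n) B b
    · simp only [hJc, if_neg hb, Matrix.trace_zero]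
  have hJlt : ∀ b ∈ (Sect2.regionOfSet (F.P (recordK₀ F Mc k + n)) (Sect2.domSites (F.P (recordK₀ F Mc k + n)) Mc (k + 1) X)).bonds, ‖Jc b‖ < α₀ := by
    intro b hb
    have hbX : b ∈ domBonds F Mc k (recordK₀ F Mc k + n) X := hb
    simp only [hJc, if_pos hbX]
    exact hcur X b hbX
  have hSat := satisfies_of_localGauges F Mc k (recordK₀ F Mc k + n) X hα₀ hα₁ Uc Jc hplaq hloc' hJtr hJlt
  rw [encodeCfg_mem_recordUc_iff]
  refine ⟨_, B12RegularSpaces111.mem_space_of_satisfies hSat, ?_⟩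
  -- `embedPair ⟨ιSU ∘ Uc, Jc⟩` is the cut pair
  show Sect2.embedPair ⟨fun b => ιSU 2 (Uc b), Jc⟩ = pairCutTorusAt F a₀ ε₂₉ Mc k (recordK₀ F Mc k + n) X B
  unfold Sect2.embedPair pairCutTorusAt
  refine Prod.ext ?_ ?_
  · funext b
    show ((ιSU 2 (Uc b) : (MatA 2)ˣ) : MatA 2) = _
    by_cases hb : b ∈ domBonds F Mc k (recordK₀ F Mc k + n) X
    · simp only [hUc, if_pos hb]; rfl
    · simp only [hUc, if_neg hb, map_one, Units.val_one]
  · funext b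
    show Jc b = _
    by_cases hb : b ∈ domBonds F Mc k (recordK₀ F Mc k + n) X
    · simp only [hJc, if_pos hb]; rfl
    · simp only [hJc, if_neg hb]

end Summit.QuantumFields.YangMills.Theorems.BalabanUVNodesPortS1

end
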